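import Summits.ValiantsHypothesis.ValiantsHypothesis.Theorems.LacunarySymmetroidMatrixDescartesWLawArrowKit

/-!
# `MatrixDescartes` (stmt-ValiantsHypothesis-18050) — W-LAW ROWS AT ALL SIZES, the ARROWHEAD LETTERS:
# positive semidefiniteness and the determinant of the pencil via the Schur complement

HONEST FRAMING.  Cell `pub-symmetroid`, seat `val-sym-mdr-p2` (gen 8); helper file `--supports` the crux
`Theses.LacunarySymmetroid.MatrixDescartes` (OPEN), NO closure claim.  Linear-algebra half of the all-sizes lower
bound `w(n) ≥ 4n − 2` for the typed W-law rows (`…WLawDefs`); the companion file `…WLawArrow` assembles the theorem.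
Nothing here bears on `MatrixDescartes` in its window, on `stub_twoSided`, `DoorA26` / `DoorA34`, the census
registers, or `VP ≠ VNP`.

THE LETTERS (support `(e; d₁, d₂; d₃) = (3; 2, 0; 5)`, index `Fin k ⊕ Fin 1`, scales `Ξᵢ > 0`, amplitudes `Uᵢ > 0`,
slack `s`):
* `P₂ = [[diag(5Ξᵢ⁷/Uᵢ), (−5Ξᵢ⁵)ᵢ], [(−5Ξᵢ⁵)ᵢᵀ, ∑ 5UᵢΞᵢ³ + 1]]`, `P₁ = [[diag(25Ξᵢ⁵/Uᵢ), (−25Ξᵢ³)ᵢ], [·ᵀ, ∑ 25UᵢΞᵢ]]`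
  — ARROWHEAD, positive semidefinite because the Schur complements of the (positive) diagonal blocks are `1` and `0`
  (`posSemidef_arrow`, via `Matrix.PosDef.fromBlocks₁₁`);
* `J = diag(5Ξᵢ⁴/Uᵢ, …, −1 − 5∑Uᵢ)` (diagonal, one negative entry), `Q = diag(Ξᵢ²/Uᵢ, …, s)` (diagonal).
THE DETERMINANT (`det_pencil_eval`): for `x > 0`,
`det(x³J + x²P₁ + P₂ + x⁵Q) = (∏ᵢ mᵢ(x)) · x³ · (x⁻³ − 1 + ∑ᵢ Uᵢ φ(x/Ξᵢ) + s x²)` with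
`mᵢ(x) = (5Ξᵢ⁷ + 25Ξᵢ⁵x² + 5Ξᵢ⁴x³ + Ξᵢ²x⁵)/Uᵢ > 0` and the reference block shape `φ` of the kit file — the
arrowhead determinant formula `det [[diag a, b], [bᵀ, c]] = (∏ aᵢ)(c − ∑ bᵢ²/aᵢ)` (`det_arrow`, via
`Matrix.det_fromBlocks₁₁`) plus the one-block identity `block_identity` (each flattened block contributes
`Uᵢ x³ φ(x/Ξᵢ)` to the Schur complement).  The letters are reindexed to `Fin (k+1)` by `finSumFinEquiv` so that the
pencil is in the format of `WLawAt`; `eval_mul_eval_neg` records that the sign of the determinant at `x > 0` is the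
sign of the scalar model plus slack.

[folklore] Elementary linear algebra over Mathlib (Schur complement lemmas `Matrix.det_fromBlocks₁₁`,
`Matrix.PosDef.fromBlocks₁₁`); tree inputs `WLawTwoWitness.eval_det_pencil₄`, `posSemidef_fromBlocks_zero`.
Axioms `propext`, `Classical.choice`, `Quot.sound`.
-/

set_option linter.dupNamespace false

namespace Summit.ValiantsHypothesis.ValiantsHypothesis.Theorems.LacunarySymmetroidMatrixDescartes

open scoped BigOperators Topology Matrix
open Filter Matrix Polynomial

namespace WLawArrow

/-- The reference block shape (as in the kit file; local notation, no definition). -/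
local notation3 (prettyPrint := false) "φ[" y "]" =>
  (5 * (y : ℝ) ^ 2 * (1 - 5 * (y : ℝ) + 5 * (y : ℝ) ^ 2 - (y : ℝ) ^ 3))
    / (5 + 25 * (y : ℝ) ^ 2 + 5 * (y : ℝ) ^ 3 + (y : ℝ) ^ 5)

/-- The scalar model (as in the kit file; local notation, no definition). -/
local notation3 (prettyPrint := false) "M[" Ξ ", " U "](" x ")" =>
  ((x : ℝ)⁻¹ ^ 3 - 1 + ∑ i, (U : Fin _ → ℝ) i * φ[(x : ℝ) / (Ξ : Fin _ → ℝ) i])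

/-! ## Arrowhead matrices: positive semidefiniteness and determinant via the Schur complement -/

/-- The row border is the conjugate transpose of the column border (real entries). [bookkeeping] -/
theorem col_conjTranspose {k : ℕ} (b : Fin k → ℝ) :
    (Matrix.of fun (i : Fin k) (_ : Fin 1) => b i)ᴴ = Matrix.of fun (_ : Fin 1) (i : Fin k) => b i := by
  ext i j
  simp

/-- The inverse of a diagonal matrix with nonzero real entries. [folklore] -/
theorem inv_diagonal_of_ne_zero {k : ℕ} (a : Fin k → ℝ) (ha : ∀ i, a i ≠ 0) :
    (diagonal a)⁻¹ = diagonal fun i => (a i)⁻¹ := by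
  refine Matrix.inv_eq_right_inv ?_
  rw [diagonal_mul_diagonal]
  convert diagonal_one with i
  exact mul_inv_cancel₀ (ha i)

/-- The Schur complement of the diagonal block of a real ARROWHEAD matrix
`[[diag a, b], [bᵀ, c]]` (`aᵢ ≠ 0`) is the `1 × 1` matrix `c − ∑ bᵢ²/aᵢ`. [folklore] -/
theorem arrow_schur {k : ℕ} (a b : Fin k → ℝ) (c : ℝ) (ha : ∀ i, a i ≠ 0) :
    Matrix.of (fun (_ _ : Fin 1) => c)
        - (Matrix.of fun (i : Fin k) (_ : Fin 1) => b i)ᴴ * (diagonal a)⁻¹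
          * (Matrix.of fun (i : Fin k) (_ : Fin 1) => b i)
      = diagonal fun _ : Fin 1 => c - ∑ i, b i ^ 2 / a i := by
  rw [inv_diagonal_of_ne_zero a ha]
  ext i j
  fin_cases i; fin_cases j
  rw [Matrix.sub_apply, Matrix.mul_apply]
  simp only [Matrix.mul_diagonal, Matrix.of_apply, Matrix.conjTranspose_apply, star_trivial,
    diagonal_apply_eq]
  congr 1
  refine Finset.sum_congr rfl fun i _ => ?_
  rw [div_eq_mul_inv, sq]
  ring

/-- **PSD criterion for real arrowhead matrices**: `[[diag a, b], [bᵀ, c]]` with `aᵢ > 0` and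
`∑ bᵢ²/aᵢ ≤ c` is positive semidefinite (Schur complement, `Matrix.PosDef.fromBlocks₁₁`). [folklore] -/
theorem posSemidef_arrow {k : ℕ} (a b : Fin k → ℝ) (c : ℝ) (ha : ∀ i, 0 < a i)
    (hc : ∑ i, b i ^ 2 / a i ≤ c) :
    (Matrix.fromBlocks (diagonal a) (Matrix.of fun (i : Fin k) (_ : Fin 1) => b i)
      (Matrix.of fun (_ : Fin 1) (i : Fin k) => b i) (Matrix.of fun (_ _ : Fin 1) => c)).PosSemidef := by
  have hA : (diagonal a).PosDef := Matrix.posDef_diagonal_iff.2 ha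
  letI : Invertible (diagonal a) := Matrix.invertibleOfIsUnitDet _ (by
    rw [det_diagonal]
    exact isUnit_iff_ne_zero.2 (Finset.prod_ne_zero_iff.2 fun i _ => (ha i).ne'))
  rw [← col_conjTranspose b, Matrix.PosDef.fromBlocks₁₁ _ _ hA,
    arrow_schur a b c fun i => (ha i).ne']
  exact posSemidef_diagonal_iff.2 fun _ => sub_nonneg.2 hc

/-- **Determinant of a real arrowhead matrix**: `det [[diag a, b], [bᵀ, c]] = (∏ aᵢ)·(c − ∑ bᵢ²/aᵢ)`
(`aᵢ ≠ 0`; `Matrix.det_fromBlocks₁₁`). [folklore] -/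
theorem det_arrow {k : ℕ} (a b : Fin k → ℝ) (c : ℝ) (ha : ∀ i, a i ≠ 0) :
    (Matrix.fromBlocks (diagonal a) (Matrix.of fun (i : Fin k) (_ : Fin 1) => b i)
      (Matrix.of fun (_ : Fin 1) (i : Fin k) => b i) (Matrix.of fun (_ _ : Fin 1) => c)).det
      = (∏ i, a i) * (c - ∑ i, b i ^ 2 / a i) := by
  letI : Invertible (diagonal a) := Matrix.invertibleOfIsUnitDet _ (by
    rw [det_diagonal]
    exact isUnit_iff_ne_zero.2 (Finset.prod_ne_zero_iff.2 fun i _ => ha i))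
  rw [← col_conjTranspose b, Matrix.det_fromBlocks₁₁, det_diagonal, invOf_eq_nonsing_inv,
    arrow_schur a b c ha, det_diagonal]
  simp

/-- A block matrix with symmetric diagonal blocks and transposed borders is symmetric. [folklore] -/
theorem isSymm_arrow {k : ℕ} (a b : Fin k → ℝ) (c : ℝ) :
    (Matrix.fromBlocks (diagonal a) (Matrix.of fun (i : Fin k) (_ : Fin 1) => b i)
      (Matrix.of fun (_ : Fin 1) (i : Fin k) => b i) (Matrix.of fun (_ _ : Fin 1) => c)).IsSymm := by
  refine Matrix.IsSymm.fromBlocks (isSymm_diagonal a) ?_ ?_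
  · ext i j; simp
  · ext i j; fin_cases i; fin_cases j; rfl

/-! ## The arrowhead W-configuration: the pencil at `x` and its determinant -/

/-- The pencil `x³ J + x² P₁ + x⁰ P₂ + x⁵ Q` of the arrowhead letters is the arrowhead matrix with diagonal
`mᵢ(x)`, border `gᵢ(x)` and corner `h(x)` (entrywise bookkeeping). [bookkeeping] -/
theorem pencil_arrow_eq {k : ℕ} (Ξ U : Fin k → ℝ) (s x : ℝ) :
    x ^ 3 • Matrix.fromBlocks (diagonal fun i => 5 * Ξ i ^ 4 / U i) 0 0
        (Matrix.of fun (_ _ : Fin 1) => -1 - 5 * ∑ i, U i)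
      + x ^ 2 • Matrix.fromBlocks (diagonal fun i => 25 * Ξ i ^ 5 / U i)
        (Matrix.of fun (i : Fin k) (_ : Fin 1) => -(25 * Ξ i ^ 3))
        (Matrix.of fun (_ : Fin 1) (i : Fin k) => -(25 * Ξ i ^ 3)) (Matrix.of fun (_ _ : Fin 1) => ∑ i, 25 * U i * Ξ i)
      + x ^ 0 • Matrix.fromBlocks (diagonal fun i => 5 * Ξ i ^ 7 / U i)
        (Matrix.of fun (i : Fin k) (_ : Fin 1) => -(5 * Ξ i ^ 5))
        (Matrix.of fun (_ : Fin 1) (i : Fin k) => -(5 * Ξ i ^ 5)) (Matrix.of fun (_ _ : Fin 1) => (∑ i, 5 * U i * Ξ i ^ 3) + 1)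
      + x ^ 5 • Matrix.fromBlocks (diagonal fun i => Ξ i ^ 2 / U i) 0 0 (Matrix.of fun (_ _ : Fin 1) => s)
    = Matrix.fromBlocks
        (diagonal fun i => (5 * Ξ i ^ 7 + 25 * Ξ i ^ 5 * x ^ 2 + 5 * Ξ i ^ 4 * x ^ 3 + Ξ i ^ 2 * x ^ 5) / U i)
        (Matrix.of fun (i : Fin k) (_ : Fin 1) => -(5 * Ξ i ^ 5 + 25 * Ξ i ^ 3 * x ^ 2))
        (Matrix.of fun (_ : Fin 1) (i : Fin k) => -(5 * Ξ i ^ 5 + 25 * Ξ i ^ 3 * x ^ 2))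
        (Matrix.of fun (_ _ : Fin 1) =>
          ((∑ i, 5 * U i * Ξ i ^ 3) + 1) + (∑ i, 25 * U i * Ξ i) * x ^ 2 + (-1 - 5 * ∑ i, U i) * x ^ 3
            + s * x ^ 5) := by
  ext i j
  rcases i with i | i <;> rcases j with j | j
  · by_cases hij : i = j
    · subst hij
      simp only [Matrix.add_apply, Matrix.smul_apply, Matrix.fromBlocks_apply₁₁, diagonal_apply_eq, smul_eq_mul]
      ring
    · simp only [Matrix.add_apply, Matrix.smul_apply, Matrix.fromBlocks_apply₁₁, diagonal_apply_ne _ hij,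
        smul_eq_mul, mul_zero, add_zero]
  · simp only [Matrix.add_apply, Matrix.smul_apply, Matrix.fromBlocks_apply₁₂, Matrix.of_apply,
      Matrix.zero_apply, smul_eq_mul]
    ring
  · simp only [Matrix.add_apply, Matrix.smul_apply, Matrix.fromBlocks_apply₂₁, Matrix.of_apply,
      Matrix.zero_apply, smul_eq_mul]
    ring
  · simp only [Matrix.add_apply, Matrix.smul_apply, Matrix.fromBlocks_apply₂₂, Matrix.of_apply, smul_eq_mul]
    ring

/-- The diagonal entries `mᵢ(x)` are positive for `x ≥ 0`. [folklore] -/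
theorem m_pos {Ξi Ui x : ℝ} (hΞ : 0 < Ξi) (hU : 0 < Ui) (hx : 0 ≤ x) :
    0 < (5 * Ξi ^ 7 + 25 * Ξi ^ 5 * x ^ 2 + 5 * Ξi ^ 4 * x ^ 3 + Ξi ^ 2 * x ^ 5) / Ui := by
  positivity

/-- **One flattened block**: its share of the Schur complement is `Uᵢ x³ φ(x/Ξᵢ)`. [folklore] -/
theorem block_identity {Ξi Ui x : ℝ} (hΞ : 0 < Ξi) (hU : 0 < Ui) (hx : 0 ≤ x) :
    5 * Ui * Ξi ^ 3 + 25 * Ui * Ξi * x ^ 2 - 5 * Ui * x ^ 3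
        - (-(5 * Ξi ^ 5 + 25 * Ξi ^ 3 * x ^ 2)) ^ 2
          / ((5 * Ξi ^ 7 + 25 * Ξi ^ 5 * x ^ 2 + 5 * Ξi ^ 4 * x ^ 3 + Ξi ^ 2 * x ^ 5) / Ui)
      = Ui * x ^ 3 * φ[x / Ξi] := by
  have hD : 0 < 5 * Ξi ^ 5 + 25 * Ξi ^ 3 * x ^ 2 + 5 * Ξi ^ 2 * x ^ 3 + x ^ 5 := by positivity
  have hden : 0 < 5 + 25 * (x / Ξi) ^ 2 + 5 * (x / Ξi) ^ 3 + (x / Ξi) ^ 5 := by positivity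
  have key : φ[x / Ξi] = 5 * x ^ 2 * (Ξi ^ 3 - 5 * Ξi ^ 2 * x + 5 * Ξi * x ^ 2 - x ^ 3)
      / (5 * Ξi ^ 5 + 25 * Ξi ^ 3 * x ^ 2 + 5 * Ξi ^ 2 * x ^ 3 + x ^ 5) := by
    rw [div_eq_div_iff hden.ne' hD.ne']
    field_simp
  have hm : (5 * Ξi ^ 7 + 25 * Ξi ^ 5 * x ^ 2 + 5 * Ξi ^ 4 * x ^ 3 + Ξi ^ 2 * x ^ 5) / Ui
      = Ξi ^ 2 * (5 * Ξi ^ 5 + 25 * Ξi ^ 3 * x ^ 2 + 5 * Ξi ^ 2 * x ^ 3 + x ^ 5) / Ui := by ring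
  rw [key, hm]
  field_simp
  ring

/-- **The Schur complement of the arrowhead pencil is `x³ · (model + s x²)`** (`x > 0`). [folklore] -/
theorem schur_eq {k : ℕ} (Ξ U : Fin k → ℝ) (hΞ : ∀ i, 0 < Ξ i) (hU : ∀ i, 0 < U i) (s : ℝ) {x : ℝ}
    (hx : 0 < x) :
    (((∑ i, 5 * U i * Ξ i ^ 3) + 1) + (∑ i, 25 * U i * Ξ i) * x ^ 2 + (-1 - 5 * ∑ i, U i) * x ^ 3 + s * x ^ 5)
        - ∑ i, (-(5 * Ξ i ^ 5 + 25 * Ξ i ^ 3 * x ^ 2)) ^ 2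
            / ((5 * Ξ i ^ 7 + 25 * Ξ i ^ 5 * x ^ 2 + 5 * Ξ i ^ 4 * x ^ 3 + Ξ i ^ 2 * x ^ 5) / U i)
      = x ^ 3 * (M[Ξ, U](x) + s * x ^ 2) := by
  have hblocks : ∑ i, U i * φ[x / Ξ i] * x ^ 3
      = ∑ i, (5 * U i * Ξ i ^ 3 + 25 * U i * Ξ i * x ^ 2 - 5 * U i * x ^ 3
        - (-(5 * Ξ i ^ 5 + 25 * Ξ i ^ 3 * x ^ 2)) ^ 2
          / ((5 * Ξ i ^ 7 + 25 * Ξ i ^ 5 * x ^ 2 + 5 * Ξ i ^ 4 * x ^ 3 + Ξ i ^ 2 * x ^ 5) / U i)) := by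
    refine Finset.sum_congr rfl fun i _ => ?_
    rw [block_identity (hΞ i) (hU i) hx.le]
    ring
  have hx3 : x⁻¹ ^ 3 * x ^ 3 = 1 := by
    rw [← mul_pow, inv_mul_cancel₀ hx.ne', one_pow]
  have hR : ∑ i, (5 * U i * Ξ i ^ 3 + 25 * U i * Ξ i * x ^ 2 - 5 * U i * x ^ 3
        - (-(5 * Ξ i ^ 5 + 25 * Ξ i ^ 3 * x ^ 2)) ^ 2
          / ((5 * Ξ i ^ 7 + 25 * Ξ i ^ 5 * x ^ 2 + 5 * Ξ i ^ 4 * x ^ 3 + Ξ i ^ 2 * x ^ 5) / U i))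
      = (∑ i, 5 * U i * Ξ i ^ 3) + (∑ i, 25 * U i * Ξ i) * x ^ 2 - (5 * ∑ i, U i) * x ^ 3
        - ∑ i, (-(5 * Ξ i ^ 5 + 25 * Ξ i ^ 3 * x ^ 2)) ^ 2
            / ((5 * Ξ i ^ 7 + 25 * Ξ i ^ 5 * x ^ 2 + 5 * Ξ i ^ 4 * x ^ 3 + Ξ i ^ 2 * x ^ 5) / U i) := by
    rw [Finset.sum_sub_distrib, Finset.sum_sub_distrib, Finset.sum_add_distrib, Finset.mul_sum, Finset.sum_mul,
      Finset.sum_mul]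
  calc _ = (1 - x ^ 3 + s * x ^ 5) + ∑ i, (5 * U i * Ξ i ^ 3 + 25 * U i * Ξ i * x ^ 2 - 5 * U i * x ^ 3
        - (-(5 * Ξ i ^ 5 + 25 * Ξ i ^ 3 * x ^ 2)) ^ 2
          / ((5 * Ξ i ^ 7 + 25 * Ξ i ^ 5 * x ^ 2 + 5 * Ξ i ^ 4 * x ^ 3 + Ξ i ^ 2 * x ^ 5) / U i)) := by
          rw [hR]
          ring
    _ = (1 - x ^ 3 + s * x ^ 5) + ∑ i, U i * φ[x / Ξ i] * x ^ 3 := by rw [hblocks]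
    _ = x ^ 3 * (M[Ξ, U](x) + s * x ^ 2) := by
          rw [← Finset.sum_mul]
          linear_combination (-1 : ℝ) * hx3

/-! ## The arrowhead letters in `Fin (k+1)` format and the determinant at `x > 0` -/

/-- The arrowhead letter `P₂` (local notation, no definition). -/
local notation3 (prettyPrint := false) "P₂blk[" Ξ ", " U "]" =>
  Matrix.fromBlocks (diagonal fun i => 5 * (Ξ : Fin _ → ℝ) i ^ 7 / (U : Fin _ → ℝ) i)
    (Matrix.of fun (i : Fin _) (_ : Fin 1) => -(5 * (Ξ : Fin _ → ℝ) i ^ 5))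
    (Matrix.of fun (_ : Fin 1) (i : Fin _) => -(5 * (Ξ : Fin _ → ℝ) i ^ 5))
    (Matrix.of fun (_ _ : Fin 1) => (∑ i, 5 * (U : Fin _ → ℝ) i * (Ξ : Fin _ → ℝ) i ^ 3) + 1)

/-- The arrowhead letter `P₁` (local notation, no definition). -/
local notation3 (prettyPrint := false) "P₁blk[" Ξ ", " U "]" =>
  Matrix.fromBlocks (diagonal fun i => 25 * (Ξ : Fin _ → ℝ) i ^ 5 / (U : Fin _ → ℝ) i)
    (Matrix.of fun (i : Fin _) (_ : Fin 1) => -(25 * (Ξ : Fin _ → ℝ) i ^ 3))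
    (Matrix.of fun (_ : Fin 1) (i : Fin _) => -(25 * (Ξ : Fin _ → ℝ) i ^ 3))
    (Matrix.of fun (_ _ : Fin 1) => ∑ i, 25 * (U : Fin _ → ℝ) i * (Ξ : Fin _ → ℝ) i)

/-- The diagonal letter `J` (local notation, no definition). -/
local notation3 (prettyPrint := false) "Jblk[" Ξ ", " U "]" =>
  Matrix.fromBlocks (diagonal fun i => 5 * (Ξ : Fin _ → ℝ) i ^ 4 / (U : Fin _ → ℝ) i) 0 0
    (Matrix.of fun (_ _ : Fin 1) => -1 - 5 * ∑ i, (U : Fin _ → ℝ) i)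

/-- The diagonal letter `Q` (local notation, no definition). -/
local notation3 (prettyPrint := false) "Qblk[" Ξ ", " U ", " s "]" =>
  Matrix.fromBlocks (diagonal fun i => (Ξ : Fin _ → ℝ) i ^ 2 / (U : Fin _ → ℝ) i) 0 0
    (Matrix.of fun (_ _ : Fin 1) => (s : ℝ))

/-- Reindexing `Fin k ⊕ Fin 1 ≃ Fin (k + 1)` (local notation). -/
local notation3 (prettyPrint := false) "rx[" A "]" => Matrix.reindex finSumFinEquiv finSumFinEquiv A

/-- The pencil of reindexed letters is the reindexed pencil. [bookkeeping] -/
theorem reindex_pencil {k : ℕ} (A B C D : Matrix (Fin k ⊕ Fin 1) (Fin k ⊕ Fin 1) ℝ) (x : ℝ) :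
    x ^ 3 • rx[A] + x ^ 2 • rx[B] + x ^ 0 • rx[C] + x ^ 5 • rx[D]
      = rx[x ^ 3 • A + x ^ 2 • B + x ^ 0 • C + x ^ 5 • D] := by
  ext i j
  simp [Matrix.reindex_apply]

/-- `J` is symmetric. [bookkeeping] -/
theorem isSymm_J {k : ℕ} (Ξ U : Fin k → ℝ) : (rx[Jblk[Ξ, U]]).IsSymm := by
  rw [Matrix.reindex_apply]
  refine Matrix.IsSymm.submatrix ?_ _
  refine Matrix.IsSymm.fromBlocks (isSymm_diagonal _) (by simp) ?_
  ext i j; fin_cases i; fin_cases j; rfl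

/-- `P₁ ⪰ 0` (Schur complement `0`). [folklore] -/
theorem posSemidef_P₁ {k : ℕ} (Ξ U : Fin k → ℝ) (hΞ : ∀ i, 0 < Ξ i) (hU : ∀ i, 0 < U i) :
    (rx[P₁blk[Ξ, U]]).PosSemidef := by
  rw [Matrix.reindex_apply]
  refine Matrix.PosSemidef.submatrix ?_ _
  refine posSemidef_arrow _ _ _ (fun i => by have := hΞ i; have := hU i; positivity) (le_of_eq ?_)
  refine Finset.sum_congr rfl fun i _ => ?_
  have h1 := (hΞ i).ne'
  have h2 := (hU i).ne'
  field_simp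

/-- `P₂ ⪰ 0` (Schur complement `1`). [folklore] -/
theorem posSemidef_P₂ {k : ℕ} (Ξ U : Fin k → ℝ) (hΞ : ∀ i, 0 < Ξ i) (hU : ∀ i, 0 < U i) :
    (rx[P₂blk[Ξ, U]]).PosSemidef := by
  rw [Matrix.reindex_apply]
  refine Matrix.PosSemidef.submatrix ?_ _
  refine posSemidef_arrow _ _ _ (fun i => by have := hΞ i; have := hU i; positivity) ?_
  have : ∑ i, (-(5 * Ξ i ^ 5)) ^ 2 / (5 * Ξ i ^ 7 / U i) = ∑ i, 5 * U i * Ξ i ^ 3 := by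
    refine Finset.sum_congr rfl fun i _ => ?_
    have h1 := (hΞ i).ne'
    have h2 := (hU i).ne'
    field_simp
  rw [this]
  linarith

/-- `Q ⪰ 0` (diagonal with nonnegative entries, `s ≥ 0`). [folklore] -/
theorem posSemidef_Q {k : ℕ} (Ξ U : Fin k → ℝ) (hU : ∀ i, 0 < U i) {s : ℝ} (hs : 0 ≤ s) :
    (rx[Qblk[Ξ, U, s]]).PosSemidef := by
  rw [Matrix.reindex_apply]
  refine Matrix.PosSemidef.submatrix ?_ _
  refine posSemidef_fromBlocks_zero (posSemidef_diagonal_iff.2 fun i => ?_) ?_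
  · have := hU i
    positivity
  · have : (Matrix.of fun (_ _ : Fin 1) => s) = diagonal fun _ => s := by
      ext i j; fin_cases i; fin_cases j; rfl
    rw [this]
    exact posSemidef_diagonal_iff.2 fun _ => hs

/-- **The determinant of the arrowhead W-pencil at `x > 0`** is
`(∏ᵢ mᵢ(x)) · x³ · (M(x) + s x²)` with `mᵢ(x) > 0`. [folklore] -/
theorem det_pencil_eval {k : ℕ} (Ξ U : Fin k → ℝ) (hΞ : ∀ i, 0 < Ξ i) (hU : ∀ i, 0 < U i) (s : ℝ)
    {x : ℝ} (hx : 0 < x) :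
    (Matrix.det (((X : ℝ[X]) ^ 3) • (rx[Jblk[Ξ, U]]).map Polynomial.C
        + ((X : ℝ[X]) ^ 2) • (rx[P₁blk[Ξ, U]]).map Polynomial.C
        + ((X : ℝ[X]) ^ 0) • (rx[P₂blk[Ξ, U]]).map Polynomial.C
        + ((X : ℝ[X]) ^ 5) • (rx[Qblk[Ξ, U, s]]).map Polynomial.C)).eval x
      = (∏ i, (5 * Ξ i ^ 7 + 25 * Ξ i ^ 5 * x ^ 2 + 5 * Ξ i ^ 4 * x ^ 3 + Ξ i ^ 2 * x ^ 5) / U i)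
        * (x ^ 3 * (M[Ξ, U](x) + s * x ^ 2)) := by
  rw [WLawTwoWitness.eval_det_pencil₄, reindex_pencil, Matrix.det_reindex_self, pencil_arrow_eq,
    det_arrow _ _ _ (fun i => (m_pos (hΞ i) (hU i) hx.le).ne'), schur_eq Ξ U hΞ hU s hx]

set_option maxHeartbeats 400000 in
/-- Hence, at positive points, the sign of the determinant is the sign of `M(x) + s x²`: opposite signs of the
latter give a negative product of the former. [bookkeeping] -/
theorem eval_mul_eval_neg {k : ℕ} (Ξ U : Fin k → ℝ) (hΞ : ∀ i, 0 < Ξ i) (hU : ∀ i, 0 < U i) (s : ℝ)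
    {x y : ℝ} (hx : 0 < x) (hy : 0 < y)
    (hneg : (M[Ξ, U](x) + s * x ^ 2) * (M[Ξ, U](y) + s * y ^ 2) < 0) :
    (Matrix.det (((X : ℝ[X]) ^ 3) • (rx[Jblk[Ξ, U]]).map Polynomial.C
        + ((X : ℝ[X]) ^ 2) • (rx[P₁blk[Ξ, U]]).map Polynomial.C
        + ((X : ℝ[X]) ^ 0) • (rx[P₂blk[Ξ, U]]).map Polynomial.C
        + ((X : ℝ[X]) ^ 5) • (rx[Qblk[Ξ, U, s]]).map Polynomial.C)).eval x
      * (Matrix.det (((X : ℝ[X]) ^ 3) • (rx[Jblk[Ξ, U]]).map Polynomial.C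
        + ((X : ℝ[X]) ^ 2) • (rx[P₁blk[Ξ, U]]).map Polynomial.C
        + ((X : ℝ[X]) ^ 0) • (rx[P₂blk[Ξ, U]]).map Polynomial.C
        + ((X : ℝ[X]) ^ 5) • (rx[Qblk[Ξ, U, s]]).map Polynomial.C)).eval y < 0 := by
  rw [det_pencil_eval Ξ U hΞ hU s hx, det_pencil_eval Ξ U hΞ hU s hy]
  have hc : 0 < (∏ i, (5 * Ξ i ^ 7 + 25 * Ξ i ^ 5 * x ^ 2 + 5 * Ξ i ^ 4 * x ^ 3 + Ξ i ^ 2 * x ^ 5) / U i)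
      * x ^ 3 := mul_pos (Finset.prod_pos fun i _ => m_pos (hΞ i) (hU i) hx.le) (pow_pos hx 3)
  have hd : 0 < (∏ i, (5 * Ξ i ^ 7 + 25 * Ξ i ^ 5 * y ^ 2 + 5 * Ξ i ^ 4 * y ^ 3 + Ξ i ^ 2 * y ^ 5) / U i)
      * y ^ 3 := mul_pos (Finset.prod_pos fun i _ => m_pos (hΞ i) (hU i) hy.le) (pow_pos hy 3)
  set A := M[Ξ, U](x) + s * x ^ 2 with hA
  set B := M[Ξ, U](y) + s * y ^ 2 with hB
  set c := (∏ i, (5 * Ξ i ^ 7 + 25 * Ξ i ^ 5 * x ^ 2 + 5 * Ξ i ^ 4 * x ^ 3 + Ξ i ^ 2 * x ^ 5) / U i) with hcdef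
  set d := (∏ i, (5 * Ξ i ^ 7 + 25 * Ξ i ^ 5 * y ^ 2 + 5 * Ξ i ^ 4 * y ^ 3 + Ξ i ^ 2 * y ^ 5) / U i) with hddef
  have : c * (x ^ 3 * A) * (d * (y ^ 3 * B)) = (c * x ^ 3) * (d * y ^ 3) * (A * B) := by ring
  rw [this]
  exact mul_neg_of_pos_of_neg (mul_pos hc hd) hneg


end WLawArrow

end Summit.ValiantsHypothesis.ValiantsHypothesis.Theorems.LacunarySymmetroidMatrixDescartes
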